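import Summits.ValiantsHypothesis.ValiantsHypothesis.Theorems.LacunarySymmetroidMatrixDescartesWLawChambers

/-!
# `MatrixDescartes` (stmt-ValiantsHypothesis-18050) — ONLY THE PIVOT BAND ALTERNATES:
# `Z₊ ≤ 1 + #{support exponents in [e + m·d_min, e + m·d_max]}` for every two-sided pivot pencil (any size, any K)

HONEST FRAMING.  Cell `pub-symmetroid`, seat `val-sym-mdr-p2` (gen 26); helper file `--supports` the crux
`Theses.LacunarySymmetroid.MatrixDescartes` (OPEN), NO closure claim.  A configuration-free form of the chamber rows of `…WLawChambers`: in a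
pivot pencil `X^e J + ∑ₖ X^{dₖ} Pₖ` of size `m + 1` (`J` ARBITRARY real, `Pₖ ⪰ 0`, two-sided: `d_min ≤ e ≤ d_max`) a row-to-letter map through
the pivot letter has exponent in the PIVOT BAND `[e + m·d_min, e + m·d_max]`; every coefficient outside the band is a coefficient of the PSD pencil
`∑ₖ X^{dₖ} Pₖ`, a sum of squares; so the coefficient sequence is «non-negative run · band · non-negative run» and Descartes' count is carried by
the band alone:
* `coeff_pivot_eq_coeff_letters_of_gt` (mirror of `WLawChambers.coeff_pivot_eq_coeff_letters_of_lt`: above `e + m·d_max` the pivot letter does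
  not contribute);
* `signVariations_le_of_two_runs_nonneg` (non-negative runs below AND above a middle part `R`: `V ≤ #supp R + 1`);
* **`card_posRoots_le_card_band_add_one`**: `Z₊ ≤ 1 + #{E ∈ supp det F : e + m·d k₋ ≤ E ≤ e + m·d k₊}` for any letters `k₋, k₊` with
  `d k₋ ≤ dₖ ≤ d k₊` for all `k` and `d k₋ ≤ e ≤ d k₊`; **`card_posRoots_le_card_bandSums_add_one`**: the same with the support replaced
  by the count-vector exponents of the band (so the bound is a function of the exponent configuration alone).
For the W-configuration the exponents below the band are the bottom run of `…WLawChambers` and the only exponent above it is the top one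
`(m+1)·d₃`; for one-sided pencils the band is everything and nothing is gained.  Nothing here bears on `MatrixDescartes` in its window, on
`stub_twoSided`, on `DoorA26` / `DoorA34`, on the cell's registers, or on `VP ≠ VNP`.

[folklore] Leibniz expansion, signed Gram expansion, Descartes' rule of signs (through the companions).  No definitions, no named facts.
-/

-- `Summit.ValiantsHypothesis.ValiantsHypothesis.…` repeats a component by the single-conjunct
-- summit layout, which the `dupNamespace` linter flags; the name is mandated.
set_option linter.dupNamespace false

namespace Summit.ValiantsHypothesis.ValiantsHypothesis.Theorems.LacunarySymmetroidMatrixDescartes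

open Polynomial Finset Matrix TrailingCoeffs WLawNotSharp WLawChambers
open scoped BigOperators Polynomial Matrix

namespace PivotBand

variable {K m : ℕ}

/-- **Above the pivot band the pivot letter does not contribute**: size `m + 1`, all letter exponents and `e` at most `d k₀`,
`e + m · d k₀ < E` ⇒ the coefficient of `X^E` is that of the letter part. [folklore] -/
theorem coeff_pivot_eq_coeff_letters_of_gt (e : ℕ) (d : Fin K → ℕ) (J : Matrix (Fin (m + 1)) (Fin (m + 1)) ℝ)
    (P : Fin K → Matrix (Fin (m + 1)) (Fin (m + 1)) ℝ) {k₀ : Fin K} (hmax : ∀ k, d k ≤ d k₀) (he : e ≤ d k₀) {E : ℕ}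
    (hE : e + m * d k₀ < E) :
    (Matrix.det (((X : ℝ[X]) ^ e) • J.map C + ∑ k, ((X : ℝ[X]) ^ d k) • (P k).map C)).coeff E
      = (Matrix.det (∑ k, ((X : ℝ[X]) ^ d k) • (P k).map C)).coeff E := by
  classical
  rw [Pivot.pivot_pencil_eq_cons, coeff_det_pencil_eq, coeff_det_pencil_eq]
  refine Finset.sum_congr rfl fun σ _ => ?_
  set d' : Fin (K + 1) → ℕ := Fin.cons e d with hd'
  set S' : Fin (K + 1) → Matrix (Fin (m + 1)) (Fin (m + 1)) ℝ := Fin.cons J P with hS'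
  have hle : ∀ l, d' l ≤ d k₀ := fun l => Fin.cases (by simpa [hd'] using he) (fun k => by simpa [hd'] using hmax k) l
  set emb : (Fin (m + 1) → Fin K) → (Fin (m + 1) → Fin (K + 1)) := fun g i => (g i).succ with hemb
  have hemb_inj : ∀ g₁ ∈ (Finset.univ : Finset (Fin (m + 1) → Fin K)), ∀ g₂ ∈ (Finset.univ : Finset (Fin (m + 1) → Fin K)),
      emb g₁ = emb g₂ → g₁ = g₂ := by
    intro g₁ _ g₂ _ h
    funext i
    have := congrFun h i
    simp only [hemb] at this
    exact Fin.succ_injective _ this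
  have hzero : ∀ f : Fin (m + 1) → Fin (K + 1), f ∉ Finset.univ.image emb →
      (if E = ∑ i, d' (f i) then ((Equiv.Perm.sign σ : ℤ) : ℝ) * ∏ i, S' (f i) (σ i) i else 0) = 0 := by
    intro f hf
    obtain ⟨i₀, hi₀⟩ : ∃ i, f i = 0 := by
      by_contra h
      push Not at h
      refine hf (Finset.mem_image.mpr ⟨fun i => (f i).pred (h i), Finset.mem_univ _, funext fun i => ?_⟩)
      simp [hemb]
    rw [if_neg]
    apply ne_of_gt
    calc (∑ i, d' (f i)) = d' (f i₀) + ∑ i ∈ Finset.univ.erase i₀, d' (f i) :=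
          (Finset.add_sum_erase Finset.univ (fun i => d' (f i)) (Finset.mem_univ i₀)).symm
      _ ≤ d' (f i₀) + ∑ _i ∈ Finset.univ.erase i₀, d k₀ := Nat.add_le_add_left (Finset.sum_le_sum fun i _ => hle (f i)) _
      _ = e + m * d k₀ := by
          rw [hi₀, Finset.sum_const, Finset.card_erase_of_mem (Finset.mem_univ _), Finset.card_univ, Fintype.card_fin,
            smul_eq_mul, Nat.add_sub_cancel, hd', Fin.cons_zero]
      _ < E := hE
  rw [← Finset.sum_subset (Finset.subset_univ (Finset.univ.image emb)) (fun f _ hf => hzero f hf), Finset.sum_image hemb_inj]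
  refine Finset.sum_congr rfl fun g _ => ?_
  simp [hd', hS', hemb]

/-- **A non-negative top run adds at most one sign change**: `g` with non-negative coefficients supported in degrees `≥ D`,
`deg R < D` ⇒ `V(g + R) ≤ V(R) + 1`. [folklore] -/
theorem signVariations_add_le_of_top_run_nonneg :
    ∀ (c : ℕ) (g R : ℝ[X]) (D : ℕ), g.support.card = c → (∀ i, 0 ≤ g.coeff i) → (∀ i ∈ g.support, D ≤ i) →
      R.degree < ((D : ℕ) : WithBot ℕ) → (g + R).signVariations ≤ R.signVariations + 1 := by
  intro c
  induction c with
  | zero =>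
    intro g R D hc _ _ _
    rw [Finset.card_eq_zero, Polynomial.support_eq_empty] at hc
    rw [hc, zero_add]; exact Nat.le_succ _
  | succ c ih =>
    intro g R D hc hnn hsupp hR
    have hg0 : g ≠ 0 := fun h => by rw [h, Polynomial.support_zero, Finset.card_empty] at hc; exact Nat.succ_ne_zero c hc.symm
    set a := g.leadingCoeff with ha
    set N := g.natDegree with hN
    have ha0 : 0 < a := lt_of_le_of_ne (hnn N) (fun h => hg0 (leadingCoeff_eq_zero.mp h.symm))
    have hsplit : g + R = C a * X ^ N + (g.eraseLead + R) := by
      have h := g.eraseLead_add_C_mul_X_pow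
      rw [← ha, ← hN] at h
      conv_lhs => rw [← h]
      ring
    have hDN : D ≤ N := hsupp N (natDegree_mem_support_of_nonzero hg0)
    have hc' : g.eraseLead.support.card = c := by have := card_support_eraseLead_add_one hg0; omega
    have hnn' : ∀ i, 0 ≤ g.eraseLead.coeff i := fun i => by
      by_cases hi : i = N
      · rw [hi, hN, eraseLead_coeff_natDegree]
      · rw [eraseLead_coeff_of_ne _ (hN ▸ hi)]; exact hnn i
    have hsupp' : ∀ i ∈ g.eraseLead.support, D ≤ i := fun i hi => by
      rw [eraseLead_support] at hi; exact hsupp i (Finset.mem_erase.mp hi).2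
    have hrec := ih g.eraseLead R D hc' hnn' hsupp' hR
    have htail : (g.eraseLead + R).degree < ((N : ℕ) : WithBot ℕ) := by
      refine (degree_add_le _ _).trans_lt (max_lt ?_ (hR.trans_le (by exact_mod_cast hDN)))
      by_cases he0 : g.eraseLead = 0
      · rw [he0, degree_zero]; exact WithBot.bot_lt_coe _
      · rcases eraseLead_natDegree_lt_or_eraseLead_eq_zero g with h1 | h1
        · rw [degree_eq_natDegree he0]; exact_mod_cast h1
        · exact absurd h1 he0
    rw [hsplit, Literature.Algebra.Polynomial.signVariations_C_mul_X_pow_add ha0.ne' htail]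
    by_cases he0 : g.eraseLead = 0
    · rw [he0, zero_add]
      gcongr
      split_ifs <;> simp
    · have hlead : (g.eraseLead + R).leadingCoeff = g.eraseLead.leadingCoeff := by
        rw [leadingCoeff_add_of_degree_lt']
        refine hR.trans_le ?_
        rw [degree_eq_natDegree he0]
        exact_mod_cast hsupp' _ (natDegree_mem_support_of_nonzero he0)
      have hpos : 0 < g.eraseLead.leadingCoeff :=
        lt_of_le_of_ne (hnn' _) (fun h => he0 (leadingCoeff_eq_zero.mp h.symm))
      rw [hlead, if_neg, add_zero]
      · exact hrec
      · rw [sign_pos ha0, sign_pos hpos]; decide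

/-- **Two non-negative runs around a middle part**: `V(g₁ + R + g₂) ≤ #supp R + 1` when `g₁, g₂` have non-negative coefficients,
`supp g₁ < D₁ ≤ supp R` and `deg (g₁ + R) < D₂ ≤ supp g₂`. [folklore] -/
theorem signVariations_le_of_two_runs_nonneg (g₁ R g₂ : ℝ[X]) (D₁ D₂ : ℕ)
    (h₁ : ∀ i, 0 ≤ g₁.coeff i) (hs₁ : ∀ i ∈ g₁.support, i < D₁) (hRlo : ∀ i ∈ R.support, D₁ ≤ i)
    (hmid : (g₁ + R).degree < ((D₂ : ℕ) : WithBot ℕ)) (h₂ : ∀ i, 0 ≤ g₂.coeff i) (hs₂ : ∀ i ∈ g₂.support, D₂ ≤ i) :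
    (g₁ + R + g₂).signVariations ≤ R.support.card + 1 := by
  classical
  rw [show g₁ + R + g₂ = g₂ + (g₁ + R) by ring]
  refine (signVariations_add_le_of_top_run_nonneg _ g₂ (g₁ + R) D₂ rfl h₂ hs₂ hmid).trans ?_
  exact Nat.add_le_add_right (signVariations_le_card_support_of_bot_run_nonneg g₁ R D₁ h₁ hs₁ hRlo) 1

/-! ### The band law -/

/-- **ONLY THE PIVOT BAND ALTERNATES.**  Pivot pencil of size `m + 1` with `K` PSD letters, `J` arbitrary real; letters `k₋, k₊` with
`d k₋ ≤ d k ≤ d k₊` for all `k` and `d k₋ ≤ e ≤ d k₊` (two-sided).  Then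
`Z₊ ≤ 1 + #{E ∈ supp det F : e + m·d k₋ ≤ E ≤ e + m·d k₊}`. [folklore] -/
theorem card_posRoots_le_card_band_add_one (e : ℕ) (d : Fin K → ℕ) (J : Matrix (Fin (m + 1)) (Fin (m + 1)) ℝ)
    (P : Fin K → Matrix (Fin (m + 1)) (Fin (m + 1)) ℝ) (hP : ∀ k, (P k).PosSemidef) {kl ku : Fin K}
    (hmin : ∀ k, d kl ≤ d k) (hmax : ∀ k, d k ≤ d ku) (hle : d kl ≤ e) (hue : e ≤ d ku) :
    ((Matrix.det (((X : ℝ[X]) ^ e) • J.map C + ∑ k, ((X : ℝ[X]) ^ d k) • (P k).map C)).roots.toFinset.filter (fun t => 0 < t)).card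
      ≤ ((Matrix.det (((X : ℝ[X]) ^ e) • J.map C + ∑ k, ((X : ℝ[X]) ^ d k) • (P k).map C)).support.filter
          (fun E => e + m * d kl ≤ E ∧ E ≤ e + m * d ku)).card + 1 := by
  classical
  set F := Matrix.det (((X : ℝ[X]) ^ e) • J.map C + ∑ k, ((X : ℝ[X]) ^ d k) • (P k).map C) with hF
  set F₀ := Matrix.det (∑ k, ((X : ℝ[X]) ^ d k) • (P k).map C) with hF₀
  set L₁ := e + m * d kl with hL₁
  set L₂ := e + m * d ku with hL₂
  have hL : L₁ ≤ L₂ := by simp only [hL₁, hL₂]; exact Nat.add_le_add_left (Nat.mul_le_mul_left m ((hmin ku))) e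
  -- split `F` into the part below the band, the band, and the part above
  set glo : ℝ[X] := ∑ i ∈ F.support.filter (fun E => E < L₁), C (F.coeff i) * X ^ i with hglo
  set ghi : ℝ[X] := ∑ i ∈ F.support.filter (fun E => L₂ < E), C (F.coeff i) * X ^ i with hghi
  set R : ℝ[X] := ∑ i ∈ F.support.filter (fun E => L₁ ≤ E ∧ E ≤ L₂), C (F.coeff i) * X ^ i with hR
  have hcoeff_sum : ∀ (S : Finset ℕ) (j : ℕ), (∑ i ∈ S, C (F.coeff i) * X ^ i).coeff j = if j ∈ S then F.coeff j else 0 := by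
    intro S j
    rw [finsetSum_coeff]
    simp only [coeff_C_mul_X_pow]
    rw [Finset.sum_ite_eq S j]
  have hsplit : F = glo + R + ghi := by
    ext j
    rw [coeff_add, coeff_add, hglo, hR, hghi, hcoeff_sum, hcoeff_sum, hcoeff_sum]
    by_cases hj : j ∈ F.support
    · simp only [Finset.mem_filter, hj, true_and]
      rcases lt_or_ge j L₁ with h | h
      · rw [if_pos h, if_neg (by omega), if_neg (by omega)]; ring
      · rcases le_or_gt j L₂ with h' | h'
        · rw [if_neg (by omega), if_pos ⟨h, h'⟩, if_neg (by omega)]; ring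
        · rw [if_neg (by omega), if_neg (by omega), if_pos h']; ring
    · simp only [Finset.mem_filter, hj, false_and, if_false, add_zero]
      exact Polynomial.notMem_support_iff.mp hj
  -- coefficients outside the band are PSD-pencil coefficients, hence `≥ 0`
  have hlo_nn : ∀ i, 0 ≤ glo.coeff i := by
    intro i; rw [hglo, hcoeff_sum]
    split_ifs with h
    · have hi : i < L₁ := (Finset.mem_filter.mp h).2
      rw [hF, coeff_pivot_eq_coeff_letters_of_lt e d J P hmin hle hi]
      exact coeff_det_psd_pencil_nonneg d P hP i
    · exact le_rfl
  have hhi_nn : ∀ i, 0 ≤ ghi.coeff i := by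
    intro i; rw [hghi, hcoeff_sum]
    split_ifs with h
    · have hi : L₂ < i := (Finset.mem_filter.mp h).2
      rw [hF, coeff_pivot_eq_coeff_letters_of_gt e d J P hmax hue hi]
      exact coeff_det_psd_pencil_nonneg d P hP i
    · exact le_rfl
  -- supports
  have hsupp_of : ∀ (S : Finset ℕ) (i : ℕ), i ∈ (∑ i ∈ S, C (F.coeff i) * X ^ i).support → i ∈ S := by
    intro S i hi
    rw [mem_support_iff, hcoeff_sum] at hi
    by_contra h; exact hi (if_neg h)
  have hs_lo : ∀ i ∈ glo.support, i < L₁ := fun i hi => (Finset.mem_filter.mp (hsupp_of _ i hi)).2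
  have hs_R : ∀ i ∈ R.support, L₁ ≤ i := fun i hi => (Finset.mem_filter.mp (hsupp_of _ i hi)).2.1
  have hs_hi : ∀ i ∈ ghi.support, L₂ + 1 ≤ i := fun i hi => (Finset.mem_filter.mp (hsupp_of _ i hi)).2
  have hmid : (glo + R).degree < ((L₂ + 1 : ℕ) : WithBot ℕ) := by
    rw [degree_lt_iff_coeff_zero]
    intro j hj
    have hj' : L₂ + 1 ≤ j := by exact_mod_cast hj
    rw [coeff_add, hglo, hR, hcoeff_sum, hcoeff_sum, if_neg, if_neg, add_zero]
    · intro h; have := (Finset.mem_filter.mp h).2; omega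
    · intro h; have := (Finset.mem_filter.mp h).2; omega
  have hV := signVariations_le_of_two_runs_nonneg glo R ghi L₁ (L₂ + 1) hlo_nn hs_lo hs_R hmid hhi_nn hs_hi
  have hRcard : R.support.card ≤ (F.support.filter (fun E => e + m * d kl ≤ E ∧ E ≤ e + m * d ku)).card :=
    Finset.card_le_card fun i hi => hsupp_of _ i hi
  have hVF : F.signVariations ≤ R.support.card + 1 := by rw [hsplit]; exact hV
  exact (WLawTwoChambers.card_posRoots_le_signVariations F).trans (hVF.trans (Nat.add_le_add_right hRcard 1))

/-- The band bound as a function of the exponent configuration: `Z₊ ≤ 1 + #{count-vector exponents in the band}` (count vectors of the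
`K + 1` letters `Fin.cons e d`). [folklore] -/
theorem card_posRoots_le_card_bandSums_add_one (e : ℕ) (d : Fin K → ℕ) (J : Matrix (Fin (m + 1)) (Fin (m + 1)) ℝ)
    (P : Fin K → Matrix (Fin (m + 1)) (Fin (m + 1)) ℝ) (hP : ∀ k, (P k).PosSemidef) {kl ku : Fin K}
    (hmin : ∀ k, d kl ≤ d k) (hmax : ∀ k, d k ≤ d ku) (hle : d kl ≤ e) (hue : e ≤ d ku) :
    ((Matrix.det (((X : ℝ[X]) ^ e) • J.map C + ∑ k, ((X : ℝ[X]) ^ d k) • (P k).map C)).roots.toFinset.filter (fun t => 0 < t)).card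
      ≤ (((Finset.univ : Finset (Sym (Fin (K + 1)) (m + 1))).image
            (fun s : Sym (Fin (K + 1)) (m + 1) => ((s : Multiset (Fin (K + 1))).map (Fin.cons e d)).sum)).filter
          (fun E => e + m * d kl ≤ E ∧ E ≤ e + m * d ku)).card + 1 := by
  classical
  refine (card_posRoots_le_card_band_add_one e d J P hP hmin hmax hle hue).trans (Nat.add_le_add_right ?_ 1)
  refine Finset.card_le_card (Finset.filter_subset_filter _ ?_)
  rw [Pivot.pivot_pencil_eq_cons]
  exact StubDescartesCeiling.support_det_pencil_subset _ _

end PivotBand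

end Summit.ValiantsHypothesis.ValiantsHypothesis.Theorems.LacunarySymmetroidMatrixDescartes
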